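import Summits.BirchSwinnertonDyer.Rank1Residual.X12.O11.RamifiedEllipticUnitMechanismZpThreeT
import Summits.BirchSwinnertonDyer.Rank1Residual.X11b.BDPRouteLocalKernelAtP
import Literature.NumberTheory.EllipticCurves.LocalPointsIntegersSubgroup
import HarnessLib

/-!
# O11 at `p = 3`: DISCHARGE of the local-kernel finiteness obligation `LocalKernelFiniteAtThree`,
# MODEL-FREE (cell `bsd-print-cfram`, seat ty2 g5 — the discharge interface; item of record
# `PrintCFram.LocalKernelFiniteThree` = stmt-BirchSwinnertonDyer-23007, route rev 16, REF A111)

HONEST FRAMING (cell `bsd-print-cfram`, HOME `run/shared/lean/pub/bsd-print-cfram/`): THEOREMS ONLY (no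
definition, no named fact, no axiom, no `sorry`); nothing about BSD is asserted or booked; the `p = 3`
slice of K12r stays OPEN (crux r6 `AnticyclotomicIndexLawThree` is untouched). This file proves the ONE
finiteness binder of ty2's regime-free typing at `3`,
`X12.O11.LocalKernelFiniteAtThree W` (p570438, labelled `@[conjecture]` only to register it as a
summit-side obligation), for EVERY elliptic `W/ℚ` — with NO global-minimality hypothesis on `W`, which is
how the route item `LocalKernelFiniteThree := ∀ W [W.IsElliptic], LocalKernelFiniteAtThree W` is filed
(REF A111: p3's frame discharger `finite_localKer_geomPrimaryTorsion_three_of_isFrameThree` (p560593)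
carries `[W.IsGloballyMinimal]` through the `ℚ_p` formal group and does not close the item by name).

The proof is shorter than the frame route and uses no frame, no twist, no reduction type, no (A𝔭)₃:

* §1 `finite_primaryComponent_point_adicCompletion` — for every elliptic curve `W` over a number
  field `K`, every finite place `v` and every prime `p`, `W(K_v)[p^∞]` is finite: `E(K_v)` has a
  torsion-free subgroup `U` of finite index (Silverman *AEC* Prop. VII.6.3 in Milne's *ADT* I Lemma 3.3
  form, tree `WeierstrassCurve.exists_finiteIndex_torsionFree_adicCompletion`, itself model-free by an
  `O_v`-integral rescaling), and `W(K_v)[p^∞] ↪ E(K_v)/U`;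
* §1 `finite_localKer_geomPrimaryTorsion` — hence, by Greenberg's Lemma 3.3 in kernel form at EVERY
  place (tree `AcSelmer.natCard_localKer_le_natCard_primaryComponent`: `#ker r_v ≤ #E(K_v)[p^∞]`, no
  hypothesis on the `ℤ_p`-extension `κ` or on the reduction), Greenberg's local kernel
  `ker r_v = ker (H¹(K_v, E[p^∞]) → H¹(K_{∞,w}, E[p^∞]))` — `localKer κ.kerSubgroup (W.geomPrimaryTorsion p) v`
  verbatim — is FINITE, with `#ker r_v ≤ #E(K_v)[p^∞]`, for every `W/K`, `p`, `κ`, `v`;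
* §2 `localKernelFiniteAtThree_holds (W) [W.IsElliptic] : LocalKernelFiniteAtThree W` — THE DISCHARGE
  (the frame and anticyclotomic binders of the obligation are simply not used), and the class-wide form
  `forall_localKernelFiniteAtThree` = the body of the route item `LocalKernelFiniteThree` verbatim, so
  that ty2's consumers `PrintCfram.cmRamifiedThreeBSD_of_indexLawAtThreeT hfin h6` (p571282) and
  `PrintCfram.cmRamifiedThreeBSD_of_imcGr_of_indexLawGr_of_localKernelFinite hfin h1 h2` (p576075) are fed
  `hfin := forall_localKernelFiniteAtThree` BY NAME.

beyond-print theorem: NO (Silverman VII.6.3 / Milne I Lemma 3.3 + Greenberg LNM 1716 Lemma 3.3).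
References: [SilvermanAEC2009] Prop. VII.6.3; [MilneADT2006] I Lemma 3.3; [GreenbergLNM1716] §3
Lemma 3.3 and its proof (pp. 73–75; kernel form `#ker r_v ≤ #E(K_v)[p^∞]`).
-/

noncomputable section

open scoped Classical

open WeierstrassCurve NumberField IsDedekindDomain Field
  Literature.NumberTheory.EllipticCurves
  Literature.NumberTheory.EllipticCurves.GreenbergSelmer
  Literature.NumberTheory.EllipticCurves.Rank1Residual
  Literature.NumberTheory.GaloisRepresentations
  Summit.BirchSwinnertonDyer.Rank1Residual
  Summit.BirchSwinnertonDyer.Rank1Residual.X11b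
  Summit.BirchSwinnertonDyer.Rank1Residual.X11b.AcSelmer

namespace Summit.BirchSwinnertonDyer.Rank1Residual.X12.O11

universe u

/-! ## §1 `E(K_v)[p^∞]` and Greenberg's local kernel are finite — every `W/K`, `p`, `κ`, `v` -/

section AnyCurve

variable {K : Type u} [Field K] [NumberField K] (W : WeierstrassCurve K) [W.IsElliptic]
  (p : ℕ) [Fact p.Prime]

/-- **`E(K_v)[p^∞]` is finite** for every elliptic curve `W` over a number field `K`, every finite place
`v` and every prime `p` (no minimality, no reduction hypothesis): `E(K_v)` has a torsion-free subgroup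
`U` of finite index, and the `p`-primary component meets `U` trivially, so it injects into the finite
quotient `E(K_v)/U`. [cite: SilvermanAEC2009, Prop. VII.6.3] [cite: MilneADT2006, I Lemma 3.3] -/
theorem finite_primaryComponent_point_adicCompletion (v : HeightOneSpectrum (𝓞 K)) :
    Finite (AddCommGroup.primaryComponent (W.baseChange (v.adicCompletion K)).toAffine.Point p) := by
  obtain ⟨U, hU, htf, -⟩ := W.exists_finiteIndex_torsionFree_adicCompletion v
  haveI := hU
  haveI : Finite ((W.baseChange (v.adicCompletion K)).toAffine.Point ⧸ U) :=
    AddSubgroup.finite_quotient_of_finiteIndex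
  refine Finite.of_injective
    (fun x : AddCommGroup.primaryComponent (W.baseChange (v.adicCompletion K)).toAffine.Point p =>
      ((x : (W.baseChange (v.adicCompletion K)).toAffine.Point) : _ ⧸ U)) ?_
  rintro ⟨x, hx⟩ ⟨y, hy⟩ hxy
  apply Subtype.ext
  have hmem : -x + y ∈ U := QuotientAddGroup.eq.mp hxy
  obtain ⟨m, hm⟩ := (AddCommGroup.mem_primaryComponent).mp hx
  obtain ⟨n, hn⟩ := (AddCommGroup.mem_primaryComponent).mp hy
  have hp0 : p ^ (m + n) ≠ 0 := pow_ne_zero _ (Fact.out : p.Prime).ne_zero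
  have hx' : p ^ (m + n) • x = 0 := by rw [pow_add, mul_nsmul, hm, nsmul_zero]
  have hy' : p ^ (m + n) • y = 0 := by rw [pow_add, mul_comm, mul_nsmul, hn, nsmul_zero]
  have h0 : p ^ (m + n) • (-x + y) = 0 := by
    rw [nsmul_add, neg_nsmul, hx', hy', neg_zero, add_zero]
  have h := htf (p ^ (m + n)) hp0 _ hmem h0
  rwa [neg_add_eq_zero] at h

/-- **Greenberg's local kernel is finite at every place, for every `ℤ_p`-extension** (Lemma 3.3 in kernel
form, `#ker r_v ≤ #E(K_v)[p^∞]`, fed with §1's finiteness of `E(K_v)[p^∞]`): for every elliptic `W` over a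
number field `K`, every prime `p`, every `ℤ_p`-extension `κ` of `K` and every finite place `v`,
`ker r_v = ker (H¹(K_v, E[p^∞]) → H¹(K_{∞,w}, E[p^∞]))` is finite and `#ker r_v ≤ #E(K_v)[p^∞]`.
[cite: GreenbergLNM1716, §3 Lemma 3.3 and its proof (pp. 73–75)] [cite: SilvermanAEC2009, Prop. VII.6.3] -/
theorem finite_localKer_geomPrimaryTorsion_and_natCard_le (κ : ZpExtension K p)
    (v : HeightOneSpectrum (𝓞 K)) :
    Finite (localKer κ.kerSubgroup (W.geomPrimaryTorsion p) v) ∧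
      Nat.card (localKer κ.kerSubgroup (W.geomPrimaryTorsion p) v) ≤
        Nat.card (AddCommGroup.primaryComponent
          (W.baseChange (v.adicCompletion K)).toAffine.Point p) := by
  haveI := finite_primaryComponent_point_adicCompletion W p v
  exact natCard_localKer_le_natCard_primaryComponent W p κ v

/-- **Greenberg's local kernel `ker r_v` is finite** — every elliptic `W` over a number field, every `p`,
every `ℤ_p`-extension `κ`, every finite place `v`. [cite: GreenbergLNM1716, §3 Lemma 3.3 and its proof (pp. 73–75)] -/
theorem finite_localKer_geomPrimaryTorsion (κ : ZpExtension K p) (v : HeightOneSpectrum (𝓞 K)) :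
    Finite (localKer κ.kerSubgroup (W.geomPrimaryTorsion p) v) :=
  (finite_localKer_geomPrimaryTorsion_and_natCard_le W p κ v).1

end AnyCurve

/-! ## §2 THE DISCHARGE of `LocalKernelFiniteAtThree` (model-free) and the item body -/

section Discharge

/-- **DISCHARGE of ty2's local-kernel finiteness obligation at `3`, for EVERY elliptic `W/ℚ`** (no global
minimality): at every `3`-frame `(K, 𝔭, W', C)` and every anticyclotomic `ℤ₃`-extension `κ` of `K`,
`ker r_𝔭` is finite — indeed for every number field `K`, every `ℤ₃`-extension and every place, by §1; the
frame and anticyclotomic binders are not used. [cite: GreenbergLNM1716, §3 Lemma 3.3 and its proof (pp. 73–75)]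
[cite: SilvermanAEC2009, Prop. VII.6.3] -/
theorem localKernelFiniteAtThree_holds (W : WeierstrassCurve ℚ) [W.IsElliptic] :
    LocalKernelFiniteAtThree W := by
  intro K _ _ 𝔭 W' _ _ C _ κ _
  haveI : Fact (Nat.Prime 3) := ⟨Nat.prime_three⟩
  haveI : (W.baseChange K).IsElliptic := by rw [baseChange]; infer_instance
  exact finite_localKer_geomPrimaryTorsion (W.baseChange K) 3 κ 𝔭

/-- **Class-wide form = the body of the route item `PrintCFram.LocalKernelFiniteThree` verbatim**
(`∀ W [W.IsElliptic], LocalKernelFiniteAtThree W`): the `hfin` input of ty2's consumers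
`PrintCfram.cmRamifiedThreeBSD_of_indexLawAtThreeT` / `…_of_imcGr_of_indexLawGr_of_localKernelFinite`,
BY NAME. [cite: GreenbergLNM1716, §3 Lemma 3.3 and its proof (pp. 73–75)] -/
theorem forall_localKernelFiniteAtThree :
    ∀ (W : WeierstrassCurve ℚ) [W.IsElliptic], LocalKernelFiniteAtThree W :=
  fun W _ => localKernelFiniteAtThree_holds W

end Discharge

end Summit.BirchSwinnertonDyer.Rank1Residual.X12.O11

end
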